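import Summits.KontsevichZagierPeriods.KontsevichZagierPeriods.Theorems.RootDecompRelativeModAbsoluteCircleSplitP01

/-! # `RootDecompRelativeModAbsoluteCircleSplitP02` — part 2/12 of the mechanical ≤400-line split of `csk_min.lean` (sha256 066c56c743abe73e…)
Source: decomp-kz lens-3 g14 CircleSplitK.lean @3d3b9378 (= CircleSplit @d1112051 §0–§25 + §26 kernel split + §27 odd→log; critic CLEARED g6-21 l.1371, g7-2 l.1388) minus the 65 declarations already landed in …CircleLogP1–P11 / …CylLogSplitP46–P49 and minus the 20 superseded g13-glue/tame-class lemmas not on the §26–§27 chain; imports …CylLogSplitP48 + …CircleLogP11; --supports stmt-KontsevichZagierPeriods-30572.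
Split by census-1 g10 `gen/splitlean.py`: scopes re-opened with their `open`/`variable`/`set_option` context; mathematics and declaration order unchanged. -/

noncomputable section
open Set MeasureTheory Filter Topology
open scoped BigOperators
open Literature.NumberTheory.Transcendental Literature.ModelTheory.ExponentialFields
namespace Summit.KontsevichZagierPeriods.RootDecompRelativeModAbsolute.Rung30571.RegularisedLogLayer.CylLog.Leaf
namespace G13
variable {b : ℕ}

open scoped ContDiff in
/-- **`CellCloseC` — the per-cell form of the residual `CylKernelZeroCirclePos`.**  On an OPEN `ℚ`-sa cell `D ⊆ ℝ¹`
with every datum `C^∞`, every `κᵢ` of FIXED SIGN (`σ`), exponents `eᵢ ∈ {1,2}` with `κᵢ > 0` whenever `eᵢ = 2`, and the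
integral identity holding POINTWISE, the cylinder representation lies in `KZ.relations`.
[EXACT normal form of the residual (both implications are formal: `cylKernelZeroCirclePos_of_cellCloseC` below, and a
cell instance is an instance); it is where `CircleLogStructure` acts (§4)] -/
def CellCloseC : Prop :=
  ∀ (D : Set (Fin 1 → ℝ)) (V : KZ.IntegralRep (1 + 1)) (a₀ : (Fin 1 → ℝ) → ℝ) (q : ℕ)
    (c κ : Fin q → (Fin 1 → ℝ) → ℝ) (M e : Fin q → ℕ) (σ : Fin q → Fin 3),
    IsOpen D → IsSemialgebraic ℚ D →
    IsSemialgebraicFunOn ℚ D a₀ → ContDiffOn ℝ ∞ a₀ D → IntegrableOn a₀ D →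
    (∀ i, IsSemialgebraicFunOn ℚ D (c i)) → (∀ i, ContDiffOn ℝ ∞ (c i) D) →
    (∀ i, IsSemialgebraicFunOn ℚ D (κ i)) → (∀ i, ContDiffOn ℝ ∞ (κ i) D) →
    (∀ i, e i = 1 ∨ e i = 2) → (∃ i, e i = 2) →
    (∀ i, ∀ x ∈ D, -1 < κ i x) →
    (∀ i, σ i = 0 → ∀ x ∈ D, 0 < κ i x) → (∀ i, σ i = 1 → ∀ x ∈ D, κ i x < 0) →
    (∀ i, σ i = 2 → ∀ x ∈ D, κ i x = 0) → (∀ i, e i = 2 → ∀ x ∈ D, 0 < κ i x) →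
    (∀ i, IntegrableOn (fun z : Fin (1 + 1) → ℝ =>
      c i (Fin.init z) * (z (Fin.last 1) ^ M i / (1 + z (Fin.last 1) ^ e i * κ i (Fin.init z))))
      {z : Fin (1 + 1) → ℝ | (Fin.init z : Fin 1 → ℝ) ∈ D ∧ z (Fin.last 1) ∈ Set.Ioo 0 1}) →
    (∀ i, IntegrableOn (fun x => c i x * ∫ θ in Set.Ioo (0 : ℝ) 1, θ ^ M i / (1 + θ ^ e i * κ i x)) D) →
    V.domain = {z : Fin (1 + 1) → ℝ | (Fin.init z : Fin 1 → ℝ) ∈ D ∧ z (Fin.last 1) ∈ Set.Ioo 0 1} →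
    Set.EqOn V.integrand (fun z => a₀ (Fin.init z) +
      ∑ i, c i (Fin.init z) * (z (Fin.last 1) ^ M i / (1 + z (Fin.last 1) ^ e i * κ i (Fin.init z))))
      V.domain →
    (∀ x ∈ D, a₀ x + ∑ i, c i x * ∫ θ in Set.Ioo (0 : ℝ) 1, θ ^ M i / (1 + θ ^ e i * κ i x) = 0) →
    KZ.of V ∈ KZ.relations

/-- **D8-top, circle twin (PROVED): `CellCloseC ⟹ CylKernelZeroCirclePos`.** -/
theorem cylKernelZeroCirclePos_of_cellCloseC (hCC : CellCloseC) : CylKernelZeroCirclePos := by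
  intro P V a₀ q c κ M e hPo hP ha₀ ha₀i hc hκ he hex hκ1 hpos hint hL1 hdom hV hae
  -- (1) an open full-measure sub-base on which all data are smooth
  obtain ⟨G₁, hG₁P, hG₁o, hG₁, hc_sm, hn₁⟩ := exists_open_smooth_subset hP c hc
  obtain ⟨G₂, hG₂G₁, hG₂o, hG₂, hκ_sm, hn₂⟩ :=
    exists_open_smooth_subset hG₁ κ fun i => (hκ i).mono hG₁P hG₁
  obtain ⟨G₃, hG₃G₂, hG₃o, hG₃, ha_sm, hn₃⟩ :=
    exists_open_smooth_subset hG₂ (fun _ : Fin 1 => a₀) fun _ => ha₀.mono (hG₂G₁.trans hG₁P) hG₂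
  have hG₃P : G₃ ⊆ P := hG₃G₂.trans (hG₂G₁.trans hG₁P)
  have hκc : ∀ i, ContinuousOn (κ i) G₃ := fun i => (hκ_sm i).continuousOn.mono hG₃G₂
  -- (2) sign cells
  obtain ⟨N, D, σ, hD, hDd, hDn, hσ0, hσ1, hσ2⟩ :=
    exists_sign_cells hG₃o hG₃ κ (fun i => (hκ i).mono hG₃P hG₃) hκc
  have hDP : ∀ j, D j ⊆ P := fun j => (hD j).2.2.trans hG₃P
  have hnull : volume (P \ ⋃ j, D j) = 0 := by
    have hsub : P \ ⋃ j, D j ⊆ (P \ G₁) ∪ ((G₁ \ G₂) ∪ ((G₂ \ G₃) ∪ (G₃ \ ⋃ j, D j))) := by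
      intro x hx
      by_cases h₁ : x ∈ G₁
      · by_cases h₂ : x ∈ G₂
        · by_cases h₃ : x ∈ G₃
          · exact Or.inr (Or.inr (Or.inr ⟨h₃, hx.2⟩))
          · exact Or.inr (Or.inr (Or.inl ⟨h₂, h₃⟩))
        · exact Or.inr (Or.inl ⟨h₁, h₂⟩)
      · exact Or.inl ⟨hx.1, h₁⟩
    exact measure_mono_null hsub
      (measure_union_null hn₁ (measure_union_null hn₂ (measure_union_null hn₃ hDn)))
  -- (3) restrict the cylinder to the cells
  have hcyl_sa : ∀ S : Set (Fin 1 → ℝ), IsSemialgebraic ℚ S →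
      IsSemialgebraic ℚ {z : Fin (1 + 1) → ℝ | (Fin.init z : Fin 1 → ℝ) ∈ S ∧ z (Fin.last 1) ∈ Set.Ioo 0 1} :=
    fun S hS => RTerm.isSemialgebraic_cyl hS
  obtain ⟨Vc, hVcd, hVci, hrel⟩ := exists_restrict_parts_ae (hcyl_sa P hP)
    (fun j => {z : Fin (1 + 1) → ℝ | (Fin.init z : Fin 1 → ℝ) ∈ D j ∧ z (Fin.last 1) ∈ Set.Ioo 0 1})
    (fun j => hcyl_sa _ (hD j).1) (fun j z hz => ⟨hDP j hz.1, hz.2⟩)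
    (fun j j' hne => Set.disjoint_left.mpr fun z hz hz' => Set.disjoint_left.mp (hDd hne) hz.1 hz'.1)
    (by
      refine measure_mono_null (fun z hz => ?_) (KZ.volume_setOf_init_mem_eq_zero hnull)
      refine ⟨hz.1.1, fun hU => hz.2 ?_⟩
      obtain ⟨j, hj⟩ := mem_iUnion.mp hU
      exact mem_iUnion.mpr ⟨j, hj, hz.1.2⟩)
    V hdom
  -- (4) each cell closes by `CellCloseC`
  have hVe : ∀ j, KZ.of (Vc j) ∈ KZ.relations := by
    intro j
    obtain ⟨hDsa, hDo, hDG₃⟩ := hD j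
    have hFc : ContinuousOn
        (fun x => a₀ x + ∑ i, c i x * ∫ θ in Set.Ioo (0 : ℝ) 1, θ ^ M i / (1 + θ ^ e i * κ i x)) (D j) :=
      ((ha_sm 0).continuousOn.mono hDG₃).add (continuousOn_finsetSum _ fun i _ =>
        continuousOn_coeff_mul_fibreIntegralE ((hc_sm i).continuousOn.mono (hDG₃.trans (hG₃G₂.trans hG₂G₁)))
          ((hκ_sm i).continuousOn.mono (hDG₃.trans hG₃G₂)) fun x hx => hκ1 i x (hDP j hx))
    have hpt := forall_eq_zero_of_ae hDo hFc (hae.mono fun x hx hxD => hx (hDP j hxD))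
    refine hCC (D j) (Vc j) a₀ q c κ M e (σ j) hDo hDsa (ha₀.mono (hDP j) hDsa) ((ha_sm 0).mono hDG₃)
      (ha₀i.mono_set (hDP j)) (fun i => (hc i).mono (hDP j) hDsa)
      (fun i => (hc_sm i).mono (hDG₃.trans (hG₃G₂.trans hG₂G₁))) (fun i => (hκ i).mono (hDP j) hDsa)
      (fun i => (hκ_sm i).mono (hDG₃.trans hG₃G₂)) he hex (fun i x hx => hκ1 i x (hDP j hx))
      (hσ0 j) (hσ1 j) (hσ2 j) (fun i hi x hx => hpos i hi x (hDP j hx))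
      (fun i => (hint i).mono_set fun z hz => ⟨hDP j hz.1, hz.2⟩)
      (fun i => (hL1 i).mono_set (hDP j)) (hVcd j) ?_ hpt
    intro z hz
    rw [hVci j]
    have hz' : z ∈ {z : Fin (1 + 1) → ℝ | (Fin.init z : Fin 1 → ℝ) ∈ D j ∧ z (Fin.last 1) ∈ Set.Ioo 0 1} :=
      hVcd j ▸ hz
    exact hV (by rw [hdom]; exact ⟨hDP j hz'.1, hz'.2⟩)
  have eq : KZ.of V = (KZ.of V - ∑ j, KZ.of (Vc j)) + ∑ j, KZ.of (Vc j) := by abel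
  rw [eq]
  exact add_mem hrel (sum_mem fun j _ => hVe j)

/-! ## §4 D8-MID (circle twin): `CellCloseC` REDUCED through the joint structure theorem `CircleLogStructure` (g12's
typed proposal, carried VERBATIM) to the cells of EXACT relations — `CellCloseCS` TYPED,
`CircleLogStructure → CellCloseCS → CellCloseC` PROVED. -/

/-- **`CircleLogStructure` APPLIED on a cell with fixed signs (PROVED modulo the hypothesis).**  Output: the a.e. open
partition of the cell; on each piece the polynomial parts cancel (`a₀ + Σ cPolyᵢ = 0`), the log coefficients `cLogᵢ` are
spanned by EXACT integer relations `∏ (1+κᵢ)^{f r i} = 1` with `ℚ`-sa coefficients, and the arctangent coefficients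
`cAtanᵢ` by EXACT angle relations `Σᵢ f′ s i · arctan(atanArgᵢ) = m s · π` whose `π`-weights cancel. -/
theorem circleStructure_cells {b q : ℕ} {C : Set (Fin b → ℝ)} (hCLS : CircleLogStructureAt b) (hC : IsSemialgebraic ℚ C)
    (e : Fin q → ℕ) (s : Fin q → Bool) {a₀ : (Fin b → ℝ) → ℝ} {c κ : Fin q → (Fin b → ℝ) → ℝ} {M : Fin q → ℕ}
    (ha₀ : IsSemialgebraicFunOn ℚ C a₀)
    (hc : ∀ i, IsSemialgebraicFunOn ℚ C (c i)) (hκ : ∀ i, IsSemialgebraicFunOn ℚ C (κ i))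
    (he : ∀ i, e i = 1 ∨ e i = 2)
    (hs : ∀ i, s i = true → ∀ x ∈ C, κ i x ≠ 0) (hs' : ∀ i, s i = false → ∀ x ∈ C, κ i x = 0)
    (hκ1 : ∀ i, ∀ x ∈ C, -1 < κ i x) (hpos : ∀ i, e i = 2 → ∀ x ∈ C, 0 < κ i x)
    (hid : ∀ x ∈ C, a₀ x + ∑ i, c i x * ∫ θ in Set.Ioo (0:ℝ) 1, θ ^ M i / (1 + θ ^ e i * κ i x) = 0) :
    ∃ (N : ℕ) (D : Fin N → Set (Fin b → ℝ)),
      (∀ d, IsSemialgebraic ℚ (D d) ∧ IsOpen (D d) ∧ D d ⊆ C) ∧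
      Pairwise (Function.onFun Disjoint D) ∧ volume (C \ ⋃ d, D d) = 0 ∧
      ∀ d, (∀ x ∈ D d, a₀ x + ∑ i, cPoly e s c κ M i x = 0) ∧
        ∃ (R : ℕ) (f : Fin R → Fin q → ℤ) (qq : Fin R → (Fin b → ℝ) → ℝ)
          (S : ℕ) (f' : Fin S → Fin q → ℤ) (m : Fin S → ℚ) (qq' : Fin S → (Fin b → ℝ) → ℝ),
          (∀ r, IsSemialgebraicFunOn ℚ (D d) (qq r)) ∧ (∀ r, ∀ x ∈ D d, ∏ i, (1 + κ i x) ^ (f r i) = 1) ∧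
          (∀ i, ∀ x ∈ D d, cLog e s c κ M i x = ∑ r, qq r x * (f r i : ℝ)) ∧
          (∀ s', IsSemialgebraicFunOn ℚ (D d) (qq' s')) ∧
          (∀ s', ∀ x ∈ D d, ∑ i, (f' s' i : ℝ) * Real.arctan (atanArg e κ i x) = (m s' : ℝ) * Real.pi) ∧
          (∀ x ∈ D d, ∑ s', qq' s' x * (m s' : ℝ) = 0) ∧
          (∀ i, ∀ x ∈ D d, cAtan e c κ M i x = ∑ s', qq' s' x * (f' s' i : ℝ)) := by
  have hW : ∀ i, IsSemialgebraicFunOn ℚ C (fun x => 1 + κ i x) := fun i =>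
    (IsSemialgebraicFunOn.add_holds (isSemialgebraicFunOn_ratCast hC 1) (hκ i)).congr fun x _ => by simp
  obtain ⟨N, D, hD, hdisj, hnull, hcell⟩ := hCLS q q C (cLog e s c κ M) (fun i x => 1 + κ i x)
    (cAtan e c κ M) (atanArg e κ) (fun x => -(a₀ x + ∑ i, cPoly e s c κ M i x)) hC
    (isSemialgebraicFunOn_cLog hC e s M hc hκ hs hpos) hW (fun i x hx => by linarith [hκ1 i x hx])
    (isSemialgebraicFunOn_cAtan hC e M hc hκ hpos) (isSemialgebraicFunOn_atanArg hC e hκ)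
    (isSemialgebraicFunOn_circRhs hC e s M ha₀ hc hκ hs hpos) (circForm_of_integralForm e s he hs hs' hκ1 hpos hid)
  refine ⟨N, D, hD, hdisj, hnull, fun d => ⟨fun x hx => ?_, (hcell d).2⟩⟩
  have h := (hcell d).1 x hx
  linarith

open scoped ContDiff in
/-- **`CellCloseCS` — the residual AFTER the joint structure theorem.**  As `CellCloseC`, on an open `ℚ`-sa cell `E`
with smooth data, fixed signs, `eᵢ ∈ {1,2}` (`κᵢ > 0` when `eᵢ = 2`), but the hypothesis is no longer the integral
identity: it is its EXACT consequence delivered by `CircleLogStructure` — the polynomial parts cancel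
(`a₀ + Σ cPolyᵢ ≡ 0`), the log coefficients `cLogᵢ` are `Σ_r qq_r · f_r i` with EXACT integer multiplicative relations
`∏ᵢ (1+κᵢ)^{f_r i} ≡ 1`, and the arctangent coefficients `cAtanᵢ` are `Σ_s qq′_s · f′_s i` with EXACT angle relations
`Σᵢ f′_s i · arctan √κᵢ ≡ m_s π` (`m_s ∈ ℚ`) and `Σ_s qq′_s m_s ≡ 0`.  [this is where `CircleBoundaryRigidity` (tame
part, lowered to order 0 and moved to honest log / arctangent monomials by `t = 1 + θκ`, `t = θ√κ`) and the wild-cell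
certificate (§5) act; UNDECIDED · ATTACKABLE-NOW; strictly beneath the residual] -/
def CellCloseCS : Prop :=
  ∀ (E : Set (Fin 1 → ℝ)) (V : KZ.IntegralRep (1 + 1)) (a₀ : (Fin 1 → ℝ) → ℝ) (q : ℕ)
    (c κ : Fin q → (Fin 1 → ℝ) → ℝ) (M e : Fin q → ℕ) (σ : Fin q → Fin 3)
    (R : ℕ) (f : Fin R → Fin q → ℤ) (qq : Fin R → (Fin 1 → ℝ) → ℝ)
    (S : ℕ) (f' : Fin S → Fin q → ℤ) (m : Fin S → ℚ) (qq' : Fin S → (Fin 1 → ℝ) → ℝ),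
    IsOpen E → IsSemialgebraic ℚ E →
    IsSemialgebraicFunOn ℚ E a₀ → ContDiffOn ℝ ∞ a₀ E → IntegrableOn a₀ E →
    (∀ i, IsSemialgebraicFunOn ℚ E (c i)) → (∀ i, ContDiffOn ℝ ∞ (c i) E) →
    (∀ i, IsSemialgebraicFunOn ℚ E (κ i)) → (∀ i, ContDiffOn ℝ ∞ (κ i) E) →
    (∀ i, e i = 1 ∨ e i = 2) → (∃ i, e i = 2) →
    (∀ i, ∀ x ∈ E, -1 < κ i x) →
    (∀ i, σ i = 0 → ∀ x ∈ E, 0 < κ i x) → (∀ i, σ i = 1 → ∀ x ∈ E, κ i x < 0) →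
    (∀ i, σ i = 2 → ∀ x ∈ E, κ i x = 0) → (∀ i, e i = 2 → ∀ x ∈ E, 0 < κ i x) →
    (∀ i, IntegrableOn (fun z : Fin (1 + 1) → ℝ =>
      c i (Fin.init z) * (z (Fin.last 1) ^ M i / (1 + z (Fin.last 1) ^ e i * κ i (Fin.init z))))
      {z : Fin (1 + 1) → ℝ | (Fin.init z : Fin 1 → ℝ) ∈ E ∧ z (Fin.last 1) ∈ Set.Ioo 0 1}) →
    (∀ i, IntegrableOn (fun x => c i x * ∫ θ in Set.Ioo (0 : ℝ) 1, θ ^ M i / (1 + θ ^ e i * κ i x)) E) →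
    V.domain = {z : Fin (1 + 1) → ℝ | (Fin.init z : Fin 1 → ℝ) ∈ E ∧ z (Fin.last 1) ∈ Set.Ioo 0 1} →
    Set.EqOn V.integrand (fun z => a₀ (Fin.init z) +
      ∑ i, c i (Fin.init z) * (z (Fin.last 1) ^ M i / (1 + z (Fin.last 1) ^ e i * κ i (Fin.init z))))
      V.domain →
    (∀ x ∈ E, a₀ x + ∑ i, cPoly e (sgnB σ) c κ M i x = 0) →
    (∀ r, IsSemialgebraicFunOn ℚ E (qq r)) →
    (∀ r, ∀ x ∈ E, ∏ i, (1 + κ i x) ^ (f r i) = 1) →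
    (∀ i, ∀ x ∈ E, cLog e (sgnB σ) c κ M i x = ∑ r, qq r x * (f r i : ℝ)) →
    (∀ s, IsSemialgebraicFunOn ℚ E (qq' s)) →
    (∀ s, ∀ x ∈ E, ∑ i, (f' s i : ℝ) * Real.arctan (atanArg e κ i x) = (m s : ℝ) * Real.pi) →
    (∀ x ∈ E, ∑ s, qq' s x * (m s : ℝ) = 0) →
    (∀ i, ∀ x ∈ E, cAtan e c κ M i x = ∑ s, qq' s x * (f' s i : ℝ)) →
    KZ.of V ∈ KZ.relations

/-- **D8-mid, circle twin (PROVED): `CircleLogStructure ⟹ CellCloseCS ⟹ CellCloseC`.** -/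
theorem cellCloseC_of_cellCloseCS (hCLS : CircleLogStructureAt 1) (h : CellCloseCS) : CellCloseC := by
  intro D V a₀ q c κ M e σ hDo hD ha₀ ha_sm ha₀i hc hc_sm hκ hκ_sm he hex hκ1 hσ0 hσ1 hσ2 hpos hint hL1 hdom hV hpt
  have hs : ∀ i, sgnB σ i = true → ∀ x ∈ D, κ i x ≠ 0 := by
    intro i hi x hx
    rcases sgnB_true hi with h0 | h1
    · exact (hσ0 i h0 x hx).ne'
    · exact (hσ1 i h1 x hx).ne
  have hs' : ∀ i, sgnB σ i = false → ∀ x ∈ D, κ i x = 0 := fun i hi x hx => hσ2 i (sgnB_false hi) x hx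
  obtain ⟨N, E, hE, hEd, hEn, hcell⟩ := circleStructure_cells hCLS hD e (sgnB σ) ha₀ hc hκ he hs hs' hκ1 hpos hpt
  have hED : ∀ d, E d ⊆ D := fun d => (hE d).2.2
  have hcyl_sa : ∀ S : Set (Fin 1 → ℝ), IsSemialgebraic ℚ S →
      IsSemialgebraic ℚ {z : Fin (1 + 1) → ℝ | (Fin.init z : Fin 1 → ℝ) ∈ S ∧ z (Fin.last 1) ∈ Set.Ioo 0 1} :=
    fun S hS => RTerm.isSemialgebraic_cyl hS
  obtain ⟨Vc, hVcd, hVci, hrel⟩ := exists_restrict_parts_ae (hcyl_sa D hD)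
    (fun d => {z : Fin (1 + 1) → ℝ | (Fin.init z : Fin 1 → ℝ) ∈ E d ∧ z (Fin.last 1) ∈ Set.Ioo 0 1})
    (fun d => hcyl_sa _ (hE d).1) (fun d z hz => ⟨hED d hz.1, hz.2⟩)
    (fun d d' hne => Set.disjoint_left.mpr fun z hz hz' => Set.disjoint_left.mp (hEd hne) hz.1 hz'.1)
    (by
      refine measure_mono_null (fun z hz => ?_) (KZ.volume_setOf_init_mem_eq_zero hEn)
      refine ⟨hz.1.1, fun hU => hz.2 ?_⟩
      obtain ⟨d, hd⟩ := mem_iUnion.mp hU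
      exact mem_iUnion.mpr ⟨d, hd, hz.1.2⟩)
    V hdom
  have hVe : ∀ d, KZ.of (Vc d) ∈ KZ.relations := by
    intro d
    obtain ⟨hEsa, hEo, -⟩ := hE d
    obtain ⟨hpoly, R, f, qq, S, f', m, qq', hqq, hprod, hcoef, hqq', hang, hπ, hcoefA⟩ := hcell d
    refine h (E d) (Vc d) a₀ q c κ M e σ R f qq S f' m qq' hEo hEsa (ha₀.mono (hED d) hEsa) (ha_sm.mono (hED d))
      (ha₀i.mono_set (hED d)) (fun i => (hc i).mono (hED d) hEsa) (fun i => (hc_sm i).mono (hED d))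
      (fun i => (hκ i).mono (hED d) hEsa) (fun i => (hκ_sm i).mono (hED d)) he hex
      (fun i x hx => hκ1 i x (hED d hx)) (fun i hi x hx => hσ0 i hi x (hED d hx))
      (fun i hi x hx => hσ1 i hi x (hED d hx)) (fun i hi x hx => hσ2 i hi x (hED d hx))
      (fun i hi x hx => hpos i hi x (hED d hx))
      (fun i => (hint i).mono_set fun z hz => ⟨hED d hz.1, hz.2⟩) (fun i => (hL1 i).mono_set (hED d))
      (hVcd d) ?_ hpoly hqq hprod hcoef hqq' hang hπ hcoefA
    intro z hz
    rw [hVci d]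
    have hz' : z ∈ {z : Fin (1 + 1) → ℝ | (Fin.init z : Fin 1 → ℝ) ∈ E d ∧ z (Fin.last 1) ∈ Set.Ioo 0 1} :=
      hVcd d ▸ hz
    exact hV (by rw [hdom]; exact ⟨hED d hz'.1, hz'.2⟩)
  have eq : KZ.of V = (KZ.of V - ∑ d, KZ.of (Vc d)) + ∑ d, KZ.of (Vc d) := by abel
  rw [eq]
  exact add_mem hrel (sum_mem fun d _ => hVe d)

/-! ## §5 THE TYPED SPLIT OF THE RESIDUAL `CellCloseCS ⟺ CellCloseCSTame ∧ CellCloseCSWild` (PROVED) and the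
`CircleBoundaryRigidity` FEED `r1C_of_circleBoundaryRigidity` (PROVED from `CircleBoundaryRigidity` BY NAME). -/

/-- **TAMENESS of a circle-kind cell** (data of `CellCloseCS`): every piece of the closed form of every index is
SEPARATELY integrable on `E`.  Log kind (`eᵢ = 1`): as the landed `TameCell` — `dᵢ log(1+κᵢ) ∈ L¹` and, for `κᵢ > 0`,
`dᵢ κᵢ^{j+1} ∈ L¹` (`j < Mᵢ`), `dᵢ = cᵢ/κᵢ^{Mᵢ+1}`.  Circle kind (`eᵢ = 2`, `κᵢ > 0`, `Mᵢ = 2j+r`): the base monomials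
`cᵢ κᵢ^{−(n+1)}` (`n < j`) and the transcendental `cᵢ κᵢ^{−j}·arctan(√κᵢ)/√κᵢ` (`r = 0`) resp.
`cᵢ κᵢ^{−(j+1)} log(1+κᵢ)` (`r = 1`) are in `L¹(E)`.  Automatic at every end of `E` except a `κᵢ → 0⁺` end with
`Mᵢ ≥ 2` (circle) / `Mᵢ ≥ 1` (log). -/
def TameCellC {q : ℕ} (E : Set (Fin 1 → ℝ)) (c κ : Fin q → (Fin 1 → ℝ) → ℝ) (M e : Fin q → ℕ)
    (σ : Fin q → Fin 3) : Prop :=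
  (∀ i, e i = 1 → σ i ≠ 2 → IntegrableOn (fun x => c i x / κ i x ^ (M i + 1) * Real.log (1 + κ i x)) E) ∧
  (∀ i, e i = 1 → σ i = 0 → ∀ j, j < M i →
    IntegrableOn (fun x => c i x / κ i x ^ (M i + 1) * κ i x ^ (j + 1)) E) ∧
  (∀ i, e i = 2 → ∀ n, n < M i / 2 → IntegrableOn (fun x => c i x / κ i x ^ (n + 1)) E) ∧
  (∀ i, e i = 2 → M i % 2 = 0 →
    IntegrableOn (fun x => c i x / κ i x ^ (M i / 2) * (Real.arctan (Real.sqrt (κ i x)) / Real.sqrt (κ i x))) E) ∧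
  (∀ i, e i = 2 → M i % 2 = 1 → IntegrableOn (fun x => c i x / κ i x ^ (M i / 2 + 1) * Real.log (1 + κ i x)) E)

open scoped ContDiff in
/-- **`CellCloseCSTame`** — `CellCloseCS` restricted to TAME cells (`TameCellC`).  [THEOREM-TYPE (KZ calculus) ·
ATTACKABLE-NOW: `⟸ CircleBoundaryRigidity` by the twin of the landed §3ag (`cellCloseLS_tame`): D1 split, the moves
cylinder → regularised band (`t = 1+θκᵢ` for `eᵢ = 1`; the scaling `t = θ√κᵢ` to `[0 < t < √κᵢ, dᵢ t^{Mᵢ}/(1+t²)]` for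
`eᵢ = 2`), the order telescopes (landed `regOrder_telescope`; `t^{M+2}/(1+t²) = t^M − t^M/(1+t²)` for the circle kind),
`t/(1+t²) ↦ s = 1+t²` for odd circle orders, and the feed `r1C_of_circleBoundaryRigidity` below (PROVED)] -/
def CellCloseCSTame : Prop :=
  ∀ (E : Set (Fin 1 → ℝ)) (V : KZ.IntegralRep (1 + 1)) (a₀ : (Fin 1 → ℝ) → ℝ) (q : ℕ)
    (c κ : Fin q → (Fin 1 → ℝ) → ℝ) (M e : Fin q → ℕ) (σ : Fin q → Fin 3)
    (R : ℕ) (f : Fin R → Fin q → ℤ) (qq : Fin R → (Fin 1 → ℝ) → ℝ)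
    (S : ℕ) (f' : Fin S → Fin q → ℤ) (m : Fin S → ℚ) (qq' : Fin S → (Fin 1 → ℝ) → ℝ),
    IsOpen E → IsSemialgebraic ℚ E →
    IsSemialgebraicFunOn ℚ E a₀ → ContDiffOn ℝ ∞ a₀ E → IntegrableOn a₀ E →
    (∀ i, IsSemialgebraicFunOn ℚ E (c i)) → (∀ i, ContDiffOn ℝ ∞ (c i) E) →
    (∀ i, IsSemialgebraicFunOn ℚ E (κ i)) → (∀ i, ContDiffOn ℝ ∞ (κ i) E) →
    (∀ i, e i = 1 ∨ e i = 2) → (∃ i, e i = 2) →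
    (∀ i, ∀ x ∈ E, -1 < κ i x) →
    (∀ i, σ i = 0 → ∀ x ∈ E, 0 < κ i x) → (∀ i, σ i = 1 → ∀ x ∈ E, κ i x < 0) →
    (∀ i, σ i = 2 → ∀ x ∈ E, κ i x = 0) → (∀ i, e i = 2 → ∀ x ∈ E, 0 < κ i x) →
    (∀ i, IntegrableOn (fun z : Fin (1 + 1) → ℝ =>
      c i (Fin.init z) * (z (Fin.last 1) ^ M i / (1 + z (Fin.last 1) ^ e i * κ i (Fin.init z))))
      {z : Fin (1 + 1) → ℝ | (Fin.init z : Fin 1 → ℝ) ∈ E ∧ z (Fin.last 1) ∈ Set.Ioo 0 1}) →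
    (∀ i, IntegrableOn (fun x => c i x * ∫ θ in Set.Ioo (0 : ℝ) 1, θ ^ M i / (1 + θ ^ e i * κ i x)) E) →
    V.domain = {z : Fin (1 + 1) → ℝ | (Fin.init z : Fin 1 → ℝ) ∈ E ∧ z (Fin.last 1) ∈ Set.Ioo 0 1} →
    Set.EqOn V.integrand (fun z => a₀ (Fin.init z) +
      ∑ i, c i (Fin.init z) * (z (Fin.last 1) ^ M i / (1 + z (Fin.last 1) ^ e i * κ i (Fin.init z))))
      V.domain →
    (∀ x ∈ E, a₀ x + ∑ i, cPoly e (sgnB σ) c κ M i x = 0) →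
    (∀ r, IsSemialgebraicFunOn ℚ E (qq r)) →
    (∀ r, ∀ x ∈ E, ∏ i, (1 + κ i x) ^ (f r i) = 1) →
    (∀ i, ∀ x ∈ E, cLog e (sgnB σ) c κ M i x = ∑ r, qq r x * (f r i : ℝ)) →
    (∀ s, IsSemialgebraicFunOn ℚ E (qq' s)) →
    (∀ s, ∀ x ∈ E, ∑ i, (f' s i : ℝ) * Real.arctan (atanArg e κ i x) = (m s : ℝ) * Real.pi) →
    (∀ x ∈ E, ∑ s, qq' s x * (m s : ℝ) = 0) →
    (∀ i, ∀ x ∈ E, cAtan e c κ M i x = ∑ s, qq' s x * (f' s i : ℝ)) →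
    TameCellC E c κ M e σ → KZ.of V ∈ KZ.relations

open scoped ContDiff in
/-- **`CellCloseCSWild`** — `CellCloseCS` restricted to WILD (non-tame) cells: some piece of the closed form is not
integrable although the fibre integrals `cᵢ ∫₀¹ θ^{Mᵢ}/(1+θ^{eᵢ}κᵢ)` are (cancellations between indices at a `κ → 0⁺`
end).  [WEAKER than the residual (a specialisation); UNDECIDED · IDEA: the MÖBIUS–RESIDUE move — after the scaling
`t = θ√κᵢ` a wild circle family is `Σᵢ [0 < t < uᵢ, dᵢ t^{2j}/(1+t²)]` with an exact angle relation
`Σ nᵢ arctan uᵢ ≡ mπ`; the Möbius rotation `φ_k(s) = (s−k)/(1+sk)` FIXES `±i`, so `(Q(φ_k(s))·φ_k′ − Q(s))/(1+s²)` has NO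
pole at `±i`: its only poles are `s = −1/k` of order ≥ 2 with zero residue, hence an ALGEBRAIC `s`-primitive and ONE
honest rule-3 move replaces the forbidden monomial unfolding (checked by hand at `j = 1`:
`φ²/(1+s²) = (1+k²)/(1+sk)² − 1/(1+s²)`); standing test §D in NODE-g13.md] -/
def CellCloseCSWild : Prop :=
  ∀ (E : Set (Fin 1 → ℝ)) (V : KZ.IntegralRep (1 + 1)) (a₀ : (Fin 1 → ℝ) → ℝ) (q : ℕ)
    (c κ : Fin q → (Fin 1 → ℝ) → ℝ) (M e : Fin q → ℕ) (σ : Fin q → Fin 3)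
    (R : ℕ) (f : Fin R → Fin q → ℤ) (qq : Fin R → (Fin 1 → ℝ) → ℝ)
    (S : ℕ) (f' : Fin S → Fin q → ℤ) (m : Fin S → ℚ) (qq' : Fin S → (Fin 1 → ℝ) → ℝ),
    IsOpen E → IsSemialgebraic ℚ E →
    IsSemialgebraicFunOn ℚ E a₀ → ContDiffOn ℝ ∞ a₀ E → IntegrableOn a₀ E →
    (∀ i, IsSemialgebraicFunOn ℚ E (c i)) → (∀ i, ContDiffOn ℝ ∞ (c i) E) →
    (∀ i, IsSemialgebraicFunOn ℚ E (κ i)) → (∀ i, ContDiffOn ℝ ∞ (κ i) E) →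
    (∀ i, e i = 1 ∨ e i = 2) → (∃ i, e i = 2) →
    (∀ i, ∀ x ∈ E, -1 < κ i x) →
    (∀ i, σ i = 0 → ∀ x ∈ E, 0 < κ i x) → (∀ i, σ i = 1 → ∀ x ∈ E, κ i x < 0) →
    (∀ i, σ i = 2 → ∀ x ∈ E, κ i x = 0) → (∀ i, e i = 2 → ∀ x ∈ E, 0 < κ i x) →
    (∀ i, IntegrableOn (fun z : Fin (1 + 1) → ℝ =>
      c i (Fin.init z) * (z (Fin.last 1) ^ M i / (1 + z (Fin.last 1) ^ e i * κ i (Fin.init z))))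
      {z : Fin (1 + 1) → ℝ | (Fin.init z : Fin 1 → ℝ) ∈ E ∧ z (Fin.last 1) ∈ Set.Ioo 0 1}) →
    (∀ i, IntegrableOn (fun x => c i x * ∫ θ in Set.Ioo (0 : ℝ) 1, θ ^ M i / (1 + θ ^ e i * κ i x)) E) →
    V.domain = {z : Fin (1 + 1) → ℝ | (Fin.init z : Fin 1 → ℝ) ∈ E ∧ z (Fin.last 1) ∈ Set.Ioo 0 1} →
    Set.EqOn V.integrand (fun z => a₀ (Fin.init z) +
      ∑ i, c i (Fin.init z) * (z (Fin.last 1) ^ M i / (1 + z (Fin.last 1) ^ e i * κ i (Fin.init z))))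
      V.domain →
    (∀ x ∈ E, a₀ x + ∑ i, cPoly e (sgnB σ) c κ M i x = 0) →
    (∀ r, IsSemialgebraicFunOn ℚ E (qq r)) →
    (∀ r, ∀ x ∈ E, ∏ i, (1 + κ i x) ^ (f r i) = 1) →
    (∀ i, ∀ x ∈ E, cLog e (sgnB σ) c κ M i x = ∑ r, qq r x * (f r i : ℝ)) →
    (∀ s, IsSemialgebraicFunOn ℚ E (qq' s)) →
    (∀ s, ∀ x ∈ E, ∑ i, (f' s i : ℝ) * Real.arctan (atanArg e κ i x) = (m s : ℝ) * Real.pi) →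
    (∀ x ∈ E, ∑ s, qq' s x * (m s : ℝ) = 0) →
    (∀ i, ∀ x ∈ E, cAtan e c κ M i x = ∑ s, qq' s x * (f' s i : ℝ)) →
    ¬ TameCellC E c κ M e σ → KZ.of V ∈ KZ.relations

end G13
end Summit.KontsevichZagierPeriods.RootDecompRelativeModAbsolute.Rung30571.RegularisedLogLayer.CylLog.Leaf
end
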